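import Literature.Topology.FourManifolds.ToricBlowupPolar
import Literature.Topology.FourManifolds.ComplexProjectiveSpaceProofs
import HarnessLib

/-!
# The punctured projective plane inside the toric model

Fourth file on the toric model `Ṽ = ToricBlowup.Model` of `Bl_p(S² × ℝ²)`. The complement of
the point `q = [0 : 0 : 1]` in the complex projective plane (`Literature.Topology.FourManifolds.ComplexProjectivePlane`)
is the total space of the line bundle `O(1) → ℂℙ¹`, `[v₀ : v₁ : v₂] ↦ [v₀ : v₁]`; a
neighbourhood of the exceptional curve `E` of `Ṽ` is the total space of `O(-1)`; the two are
diffeomorphic as real manifolds by the fibrewise conjugate-linear isomorphism. Explicitly: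

* `ToricBlowup.bdC v = v̄₂ (v₀, v₁) / (|v₀|² + |v₁|²)` — the blow-down coordinates of `[v]`;
* `ToricBlowup.GE : ℂℙ² → Ṽ`, `[v] ↦ Φ₂ ((bdC v)₁, v₁/v₀)` (`v₀ ≠ 0`), `Φ₃ (v₀/v₁, (bdC v)₂)`
  (`v₁ ≠ 0`); in the affine charts `[1 : a : b] ↦ Φ₂ (b̄/(1+|a|²), a)`,
  `[c : 1 : d] ↦ Φ₃ (c, d̄/(1+|c|²))` (`GE_affine₀`, `GE_affine₁`), and on the chart centred at
  `q`, `[w : 1] ↦ liftDisc (w/‖w‖²)` (`GE_affine₂`: the inversion of Kervaire–Milnor's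
  connected-sum parameter appears here); it maps the line at infinity `{v₂ = 0}` onto `E`;
* `ToricBlowup.GEinv`, `ToricBlowup.GEPH` — the inverse `Φ₂ (u, m) ↦ [1 : m : ū (1+|m|²)]`,
  `Φ₃ (k, w) ↦ [k : 1 : w̄ (1+|k|²)]` and the resulting open partial diffeomorphism
  `ℂℙ² ∖ {q} ≅ U₂ ∪ U₃ = Ṽ ∖ sFibre`, smooth with smooth inverse;
* `ToricBlowup.eTwo = squeezeM ∘ GE` — the embedding of the second summand of the neck
  presentation, with range `{bdRad < 1/8} ∖ sFibre` and the **matching**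
  `eTwo ((affineChart 2).symm (t • θ)) = liftDisc (γ(-t) • θ)` (`eTwo_affine₂_smul`).

Sources: Griffiths–Harris, *Principles of Algebraic Geometry*, Ch. 1 §1 (the blow-up and the
bundles `O(±1)`), Ch. 0 §2 (affine charts of `ℂℙⁿ`, the tree's `affineChart`).
-/

noncomputable section

open scoped Manifold ContDiff Topology ComplexConjugate
open Set Function Metric Module Complex

namespace Literature.Topology.FourManifolds

/-- Local notation: `𝔼 n` is the model Euclidean space `EuclideanSpace ℝ (Fin n)`. -/
local notation "𝔼 " n:arg => EuclideanSpace ℝ (Fin n)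

/-- Local notation: `𝕊 n` is the unit sphere in `EuclideanSpace ℝ (Fin (n + 1))`. -/
local notation "𝕊 " n:arg => (Metric.sphere (0 : EuclideanSpace ℝ (Fin (n + 1))) 1)

namespace ToricBlowup

open SphereCoord ComplexProjectiveSpace

/-! ### Homogeneous coordinates and the affine charts of `ℂℙ²` in the `toC2` convention -/

/-- A vector with a nonzero entry is nonzero. [folklore] -/
theorem vec3_ne_zero {v : Fin 3 → ℂ} (i : Fin 3) (h : v i ≠ 0) : v ≠ 0 := fun hv => h (by simp [hv])

/-- The point `[a : b : c]` of `ℂℙ²` (for a nonzero triple). [folklore] -/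
def pt (v : Fin 3 → ℂ) (h : v ≠ 0) : ComplexProjectivePlane := mk ⟨v, h⟩

/-- The distinguished point `q = [0 : 0 : 1]` (the centre of the third affine chart; the point at
which `ℂℙ²` is punctured for the connected sum). [folklore] -/
def qPt : ComplexProjectivePlane := pt ![0, 0, 1] (vec3_ne_zero 2 (by simp))

/-- The real coordinates `ℝ⁴ → ℂ²` of the tree's affine charts agree with `toC2`. [folklore] -/
theorem realCoordinates_two_symm (w : 𝔼 4) :
    ((realCoordinates 2).symm w : Fin 2 → ℂ) = ![(toC2 w).1, (toC2 w).2] := by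
  funext j
  fin_cases j <;> rfl

/-- Homogeneous coordinates of the inverse of the affine chart `0`: `(a, b) ↦ (1, a, b)`. [folklore] -/
theorem coe_homogenize_zero (x : Fin 2 → ℂ) :
    ((homogenize (n := 2) 0 x : {v : Fin 3 → ℂ // v ≠ 0}) : Fin 3 → ℂ) = ![1, x 0, x 1] := by
  funext j; fin_cases j <;> rfl

/-- Homogeneous coordinates of the inverse of the affine chart `1`: `(c, d) ↦ (c, 1, d)`. [folklore] -/
theorem coe_homogenize_one (x : Fin 2 → ℂ) :
    ((homogenize (n := 2) 1 x : {v : Fin 3 → ℂ // v ≠ 0}) : Fin 3 → ℂ) = ![x 0, 1, x 1] := by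
  funext j; fin_cases j <;> rfl

/-- Homogeneous coordinates of the inverse of the affine chart `2`: `(a, b) ↦ (a, b, 1)`. [folklore] -/
theorem coe_homogenize_two (x : Fin 2 → ℂ) :
    ((homogenize (n := 2) 2 x : {v : Fin 3 → ℂ // v ≠ 0}) : Fin 3 → ℂ) = ![x 0, x 1, 1] := by
  funext j; fin_cases j <;> rfl

/-- Two nonzero triples with the same entries define the same point. [folklore] -/
theorem pt_congr {v w : Fin 3 → ℂ} (hv : v ≠ 0) (hw : w ≠ 0) (h : v = w) : pt v hv = pt w hw := by
  subst h; rfl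

/-- `mk` of a subtype is `pt` of its value. [folklore] -/
theorem mk_eq_pt (v : {v : Fin 3 → ℂ // v ≠ 0}) : mk v = pt v.1 v.2 := rfl

/-- **The inverse of the affine chart `0`** in the `toC2` convention: `w ↦ [1 : u : w']`,
`(u, w') = toC2 w`. [folklore] -/
theorem affineChart_zero_symm (w : 𝔼 4) :
    (affineChart (n := 2) 0).symm w =
      pt ![1, (toC2 w).1, (toC2 w).2] (vec3_ne_zero 0 (by simp)) := by
  rw [affineChart_symm_apply, mk_eq_pt]
  apply pt_congr
  rw [coe_homogenize_zero, realCoordinates_two_symm]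
  rfl

/-- **The inverse of the affine chart `1`**: `w ↦ [u : 1 : w']`. [folklore] -/
theorem affineChart_one_symm (w : 𝔼 4) :
    (affineChart (n := 2) 1).symm w =
      pt ![(toC2 w).1, 1, (toC2 w).2] (vec3_ne_zero 1 (by simp)) := by
  rw [affineChart_symm_apply, mk_eq_pt]
  apply pt_congr
  rw [coe_homogenize_one, realCoordinates_two_symm]
  rfl

/-- **The inverse of the affine chart `2`** (the disc centred at `q`): `w ↦ [u : w' : 1]`.
[folklore] -/
theorem affineChart_two_symm (w : 𝔼 4) :
    (affineChart (n := 2) 2).symm w =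
      pt ![(toC2 w).1, (toC2 w).2, 1] (vec3_ne_zero 2 (by simp)) := by
  rw [affineChart_symm_apply, mk_eq_pt]
  apply pt_congr
  rw [coe_homogenize_two, realCoordinates_two_symm]
  rfl

/-- The centre of the third affine chart is `q`. [folklore] -/
theorem affineChart_two_symm_zero : (affineChart (n := 2) 2).symm 0 = qPt := by
  rw [affineChart_two_symm, qPt]
  apply pt_congr
  simp

/-- Scaling criterion: `[v] = [w]` if `a • w = v` for some (necessarily nonzero) `a`. [folklore] -/
theorem pt_eq_pt_of_smul {v w : Fin 3 → ℂ} (hv : v ≠ 0) (hw : w ≠ 0) (a : ℂ) (h : a • w = v) :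
    pt v hv = pt w hw :=
  (mk_eq_mk_iff ⟨v, hv⟩ ⟨w, hw⟩).2 ⟨a, h⟩

/-- If `[v] = [w]` then `v = a • w` for some `a ≠ 0`. [folklore] -/
theorem exists_smul_of_pt_eq {v w : Fin 3 → ℂ} (hv : v ≠ 0) (hw : w ≠ 0) (h : pt v hv = pt w hw) :
    ∃ a : ℂ, a ≠ 0 ∧ a • w = v := by
  obtain ⟨a, ha⟩ := (mk_eq_mk_iff ⟨v, hv⟩ ⟨w, hw⟩).1 h
  refine ⟨a, ?_, ha⟩
  rintro rfl
  exact hv (by simpa using ha.symm)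

/-- A point is `q` iff its first two homogeneous coordinates vanish. [folklore] -/
theorem pt_eq_qPt_iff {v : Fin 3 → ℂ} (hv : v ≠ 0) : pt v hv = qPt ↔ v 0 = 0 ∧ v 1 = 0 := by
  constructor
  · intro h
    obtain ⟨a, -, ha⟩ := exists_smul_of_pt_eq hv _ h
    rw [← ha]; simp
  · rintro ⟨h0, h1⟩
    have h2 : v 2 ≠ 0 := by
      intro h2; apply hv; funext j; fin_cases j <;> assumption
    refine pt_eq_pt_of_smul hv _ (v 2) ?_
    funext j
    fin_cases j <;> simp [h0, h1]

/-! ### The blow-down coordinates and the map `GE` -/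

/-- **The blow-down coordinates** `(u, w) = v̄₂ (v₀, v₁) / (|v₀|² + |v₁|²)` of a homogeneous
triple: the image in `O(-1) ⊂ ℂ² × ℂℙ¹` of the point of `O(1)` under the fibrewise
conjugate-linear isomorphism (junk `0` when `v₀ = v₁ = 0`). [folklore] -/
def bdC (v : Fin 3 → ℂ) : ℂ × ℂ :=
  (conj (v 2) * v 0 * (((normSq (v 0) + normSq (v 1) : ℝ) : ℂ))⁻¹,
    conj (v 2) * v 1 * (((normSq (v 0) + normSq (v 1) : ℝ) : ℂ))⁻¹)

/-- The blow-down coordinates are homogeneous of degree `0`. [folklore] -/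
theorem bdC_smul {t : ℂ} (ht : t ≠ 0) (v : Fin 3 → ℂ) : bdC (t • v) = bdC v := by
  have htn : ((normSq t : ℝ) : ℂ) ≠ 0 := ofReal_ne_zero.2 (by rwa [Ne, normSq_eq_zero])
  have ht' : conj t * t = (normSq t : ℂ) := by rw [mul_comm, mul_conj]
  by_cases hN : normSq (v 0) + normSq (v 1) = 0
  · have h0 : v 0 = 0 := normSq_eq_zero.1 (by nlinarith [normSq_nonneg (v 0), normSq_nonneg (v 1)])
    have h1 : v 1 = 0 := normSq_eq_zero.1 (by nlinarith [normSq_nonneg (v 0), normSq_nonneg (v 1)])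
    simp [bdC, h0, h1]
  · have hN' : ((normSq (v 0) : ℂ)) + (normSq (v 1) : ℂ) ≠ 0 := by exact_mod_cast hN
    simp only [bdC, Pi.smul_apply, smul_eq_mul, map_mul]
    push_cast
    have e : (normSq t : ℂ) * (normSq (v 0) : ℂ) + (normSq t : ℂ) * (normSq (v 1) : ℂ) =
        (normSq t : ℂ) * ((normSq (v 0) : ℂ) + (normSq (v 1) : ℂ)) := by ring
    rw [e, mul_inv]
    refine Prod.ext ?_ ?_ <;> dsimp only
    · calc conj t * conj (v 2) * (t * v 0) * (((normSq t : ℂ))⁻¹ *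
          (((normSq (v 0) : ℂ)) + (normSq (v 1) : ℂ))⁻¹)
          = (conj t * t) * ((normSq t : ℂ))⁻¹ *
            (conj (v 2) * v 0 * (((normSq (v 0) : ℂ)) + (normSq (v 1) : ℂ))⁻¹) := by ring
        _ = conj (v 2) * v 0 * (((normSq (v 0) : ℂ)) + (normSq (v 1) : ℂ))⁻¹ := by
          rw [ht', mul_inv_cancel₀ htn, one_mul]
    · calc conj t * conj (v 2) * (t * v 1) * (((normSq t : ℂ))⁻¹ *
          (((normSq (v 0) : ℂ)) + (normSq (v 1) : ℂ))⁻¹)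
          = (conj t * t) * ((normSq t : ℂ))⁻¹ *
            (conj (v 2) * v 1 * (((normSq (v 0) : ℂ)) + (normSq (v 1) : ℂ))⁻¹) := by ring
        _ = conj (v 2) * v 1 * (((normSq (v 0) : ℂ)) + (normSq (v 1) : ℂ))⁻¹ := by
          rw [ht', mul_inv_cancel₀ htn, one_mul]

/-- The map `GE` on homogeneous triples. [folklore] -/
def GErep (v : Fin 3 → ℂ) : Model :=
  if v 0 = 0 then Φ₃ (0, (bdC v).2) else Φ₂ ((bdC v).1, v 1 / v 0)

/-- `GErep` is homogeneous of degree `0`. [folklore] -/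
theorem GErep_smul {t : ℂ} (ht : t ≠ 0) (v : Fin 3 → ℂ) : GErep (t • v) = GErep v := by
  simp only [GErep, bdC_smul ht, Pi.smul_apply, smul_eq_mul, mul_eq_zero, ht, false_or,
    mul_div_mul_left _ _ ht]

/-- **The embedding of the punctured projective plane into the toric model**:
`[v] ↦ Φ₂ ((bdC v)₁, v₁/v₀)` for `v₀ ≠ 0`, `Φ₃ (0, (bdC v)₂)` for `v₀ = 0` (junk at `q`).
[folklore] -/
def GE : ComplexProjectivePlane → Model :=
  Projectivization.lift (fun v => GErep (v : Fin 3 → ℂ)) (by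
    rintro a b t h
    have ht : t ≠ 0 := by rintro rfl; exact a.2 (by simpa using h)
    change GErep (a : Fin 3 → ℂ) = GErep (b : Fin 3 → ℂ)
    rw [h, GErep_smul ht])

/-- `GE [v] = GErep v`. [folklore] -/
@[simp] theorem GE_pt (v : Fin 3 → ℂ) (hv : v ≠ 0) : GE (pt v hv) = GErep v := rfl

/-- `GE` for `v₀ ≠ 0`. [folklore] -/
theorem GE_pt_of_ne_zero {v : Fin 3 → ℂ} (hv : v ≠ 0) (h0 : v 0 ≠ 0) :
    GE (pt v hv) = Φ₂ ((bdC v).1, v 1 / v 0) := by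
  rw [GE_pt, GErep, if_neg h0]

/-- `GE` for `v₀ = 0`. [folklore] -/
theorem GE_pt_of_eq_zero {v : Fin 3 → ℂ} (hv : v ≠ 0) (h0 : v 0 = 0) :
    GE (pt v hv) = Φ₃ (0, (bdC v).2) := by
  rw [GE_pt, GErep, if_pos h0]

/-- **`GE` in the third chart**: `[v] ↦ Φ₃ (v₀/v₁, (bdC v)₂)` whenever `v₁ ≠ 0` (the two chart
expressions agree where both apply). [folklore] -/
theorem GE_pt_of_ne_zero' {v : Fin 3 → ℂ} (hv : v ≠ 0) (h1 : v 1 ≠ 0) :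
    GE (pt v hv) = Φ₃ (v 0 / v 1, (bdC v).2) := by
  by_cases h0 : v 0 = 0
  · rw [GE_pt_of_eq_zero hv h0, h0, zero_div]
  · have hm : v 1 / v 0 ≠ 0 := div_ne_zero h1 h0
    rw [GE_pt_of_ne_zero hv h0, Φ₂_eq_Φ₃ (p := ((bdC v).1, v 1 / v 0)) hm]
    congr 1
    simp only [τ₂₃, inv_div, bdC, Prod.mk.injEq, true_and]
    field_simp

/-- **`GE` in the affine chart `0`**: `[1 : a : b] ↦ Φ₂ (b̄/(1 + |a|²), a)`. [folklore] -/
theorem GE_affine₀ (w : 𝔼 4) : GE ((affineChart (n := 2) 0).symm w) =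
    Φ₂ (conj (toC2 w).2 * (((1 + normSq (toC2 w).1 : ℝ) : ℂ))⁻¹, (toC2 w).1) := by
  rw [affineChart_zero_symm, GE_pt_of_ne_zero _ (by simp)]
  simp [bdC]

/-- **`GE` in the affine chart `1`**: `[c : 1 : d] ↦ Φ₃ (c, d̄/(|c|² + 1))`. [folklore] -/
theorem GE_affine₁ (w : 𝔼 4) : GE ((affineChart (n := 2) 1).symm w) =
    Φ₃ ((toC2 w).1, conj (toC2 w).2 * (((normSq (toC2 w).1 + 1 : ℝ) : ℂ))⁻¹) := by
  rw [affineChart_one_symm, GE_pt_of_ne_zero' _ (by simp)]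
  simp [bdC]

/-- **`GE` on the disc centred at `q`**: `[w : 1] ↦ liftDisc (w/‖w‖²)` for `w ≠ 0` — Kervaire–
Milnor's inversion of the connected-sum parameter. [folklore] -/
theorem GE_affine₂ {w : 𝔼 4} (hw : w ≠ 0) :
    GE ((affineChart (n := 2) 2).symm w) = liftDisc ((‖w‖ ^ 2)⁻¹ • w) := by
  have hN : normSq (toC2 w).1 + normSq (toC2 w).2 = ‖w‖ ^ 2 := (norm_sq_eq_normSq w).symm
  have hn0 : ‖w‖ ^ 2 ≠ 0 := pow_ne_zero _ (norm_ne_zero_iff.2 hw)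
  have hw' : ((‖w‖ : ℝ) : ℂ) ≠ 0 := ofReal_ne_zero.2 (norm_ne_zero_iff.2 hw)
  set c : ℂ := (((‖w‖ : ℝ) : ℂ) ^ 2)⁻¹ with hc
  have hc0 : c ≠ 0 := inv_ne_zero (pow_ne_zero _ hw')
  have hs : toC2 ((‖w‖ ^ 2)⁻¹ • w) = (c * (toC2 w).1, c * (toC2 w).2) := by
    rw [toC2_smul]; push_cast; rw [← hc]
  have hNc : ((normSq (toC2 w).1 + normSq (toC2 w).2 : ℝ) : ℂ) = c⁻¹ := by
    rw [hN, hc, inv_inv]; push_cast; rfl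
  rw [affineChart_two_symm]
  by_cases hu : (toC2 w).1 = 0
  · -- over the north pole of the disc: the `Φ₃` expressions
    have hv : (toC2 w).2 ≠ 0 := by
      intro h; apply hw; rw [← toC2_eq_zero_iff]; exact Prod.ext hu h
    rw [GE_pt_of_eq_zero _ (by simp [hu]), liftDisc_eq_Φ₃ (v := (‖w‖ ^ 2)⁻¹ • w)]
    · rw [hs]
      simp only [bdC, Fin.isValue, Matrix.cons_val_zero, Matrix.cons_val_one, Matrix.cons_val,
        map_one, one_mul, hNc, inv_inv]
      congr 1
      refine Prod.ext ?_ ?_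
      · dsimp only; rw [hu]; simp
      · dsimp only; ring
    · rw [hs]; exact mul_ne_zero hc0 hv
  · rw [GE_pt_of_ne_zero _ (by simp [hu]), liftDisc_eq_Φ₂ (v := (‖w‖ ^ 2)⁻¹ • w)]
    · rw [hs]
      simp only [bdC, Fin.isValue, Matrix.cons_val_zero, Matrix.cons_val_one, Matrix.cons_val,
        map_one, one_mul, hNc, inv_inv]
      congr 1
      refine Prod.ext ?_ ?_
      · dsimp only; ring
      · dsimp only; field_simp
    · rw [hs]; exact mul_ne_zero hc0 hu

/-- `GE` takes values off the south-pole fibre. [folklore] -/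
theorem GE_not_mem_sFibre (y : ComplexProjectivePlane) : GE y ∉ sFibre := by
  induction y using ind with
  | h v =>
    rw [mk_eq_pt]
    by_cases h0 : (v : Fin 3 → ℂ) 0 = 0
    · rw [GE_pt_of_eq_zero _ h0]; exact Φ₃_not_mem_sFibre _
    · rw [GE_pt_of_ne_zero _ h0]; exact Φ₂_not_mem_sFibre _

/-! ### The inverse map -/

/-- The chart-`U₂` inverse: `(u, m) ↦ [1 : m : ū (1 + |m|²)]`. [folklore] -/
def geInv₂ (p : ℂ × ℂ) : ComplexProjectivePlane :=
  (affineChart (n := 2) 0).symm (fromC2 (p.2, conj p.1 * (((1 + normSq p.2 : ℝ) : ℂ))))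

/-- The chart-`U₃` inverse: `(k, w) ↦ [k : 1 : w̄ (|k|² + 1)]`. [folklore] -/
def geInv₃ (p : ℂ × ℂ) : ComplexProjectivePlane :=
  (affineChart (n := 2) 1).symm (fromC2 (p.1, conj p.2 * (((normSq p.1 + 1 : ℝ) : ℂ))))

/-- `geInv₂` as a point. [folklore] -/
theorem geInv₂_eq (p : ℂ × ℂ) : geInv₂ p =
    pt ![1, p.2, conj p.1 * (((1 + normSq p.2 : ℝ) : ℂ))] (vec3_ne_zero 0 (by simp)) := by
  rw [geInv₂, affineChart_zero_symm]; apply pt_congr; simp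

/-- `geInv₃` as a point. [folklore] -/
theorem geInv₃_eq (p : ℂ × ℂ) : geInv₃ p =
    pt ![p.1, 1, conj p.2 * (((normSq p.1 + 1 : ℝ) : ℂ))] (vec3_ne_zero 1 (by simp)) := by
  rw [geInv₃, affineChart_one_symm]; apply pt_congr; simp

/-- The two chart inverses agree on the overlap `U₂ ∩ U₃`. [folklore] -/
theorem geInv₂_eq_geInv₃ {p : ℂ × ℂ} (hm : p.2 ≠ 0) : geInv₂ p = geInv₃ (τ₂₃ p) := by
  obtain ⟨u, m⟩ := p
  change m ≠ 0 at hm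
  rw [geInv₂_eq, geInv₃_eq]
  refine pt_eq_pt_of_smul _ _ m ?_
  have hmn : ((normSq m : ℝ) : ℂ) ≠ 0 := ofReal_ne_zero.2 (by rwa [Ne, normSq_eq_zero])
  funext j
  fin_cases j
  · simp [τ₂₃, hm]
  · simp [τ₂₃]
  · simp only [τ₂₃, Pi.smul_apply, smul_eq_mul, map_mul, normSq_inv]
    push_cast
    have hm' : m * conj m = (normSq m : ℂ) := mul_conj m
    field_simp
    linear_combination (conj u) * (1 + (normSq m : ℂ)) * hm'

/-- The inverse of `GE` on `U₁ ∪ U₂` (junk on the south-pole fibre). [folklore] -/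
def geInv₁₂ : V₁₂ → ComplexProjectivePlane :=
  data₁₂.lift (fun p => geInv₂ (τ₁₂ p)) geInv₂ (by
    rintro p hp
    rfl)

/-- **The inverse of `GE`** on `Ṽ ∖ sFibre = U₂ ∪ U₃` (junk on the south-pole fibre). [folklore] -/
def GEinv : Model → ComplexProjectivePlane :=
  data₃.lift geInv₁₂ geInv₃ (by
    rintro x ⟨p, hp, rfl⟩
    exact geInv₂_eq_geInv₃ hp)

/-- `GEinv` on the chart `U₂`. [folklore] -/
@[simp] theorem GEinv_Φ₂ (p : ℂ × ℂ) : GEinv (Φ₂ p) = geInv₂ p := rfl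

/-- `GEinv` on the chart `U₃`. [folklore] -/
@[simp] theorem GEinv_Φ₃ (p : ℂ × ℂ) : GEinv (Φ₃ p) = geInv₃ p := rfl

/-- **`GE ∘ GEinv = id` off the south-pole fibre.** [folklore] -/
theorem GE_GEinv {v : Model} (hv : v ∉ sFibre) : GE (GEinv v) = v := by
  rcases (not_mem_sFibre_iff v).1 hv with ⟨⟨u, m⟩, rfl⟩ | ⟨⟨k, w⟩, rfl⟩
  · rw [GEinv_Φ₂, geInv₂_eq, GE_pt_of_ne_zero _ (by simp)]
    have hn : ((1 + normSq m : ℝ) : ℂ) ≠ 0 :=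
      ofReal_ne_zero.2 (add_pos_of_pos_of_nonneg one_pos (normSq_nonneg m)).ne'
    congr 1
    simp only [bdC, Matrix.cons_val_zero, Matrix.cons_val_one, Matrix.cons_val, map_mul, conj_conj,
      conj_ofReal, normSq_one, mul_one, div_one, Prod.mk.injEq, and_true]
    field_simp
  · rw [GEinv_Φ₃, geInv₃_eq, GE_pt_of_ne_zero' _ (by simp)]
    have hn : ((normSq k + 1 : ℝ) : ℂ) ≠ 0 :=
      ofReal_ne_zero.2 (add_pos_of_nonneg_of_pos (normSq_nonneg k) one_pos).ne'
    congr 1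
    simp only [bdC, Matrix.cons_val_zero, Matrix.cons_val_one, Matrix.cons_val, map_mul, conj_conj,
      conj_ofReal, normSq_one, mul_one, div_one, Prod.mk.injEq, true_and]
    field_simp

/-- `GEinv ∘ GE = id` on `[0 : b : c]`, `b ≠ 0`. [folklore] -/
theorem GEinv_GE_aux₀ {b c : ℂ} (hb : b ≠ 0) (h : (![0, b, c] : Fin 3 → ℂ) ≠ 0) :
    geInv₃ (0, (bdC ![0, b, c]).2) = pt ![0, b, c] h := by
  rw [geInv₃_eq]
  symm
  refine pt_eq_pt_of_smul _ _ b ?_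
  have hbn : ((normSq b : ℝ) : ℂ) ≠ 0 := ofReal_ne_zero.2 (by rwa [Ne, normSq_eq_zero])
  have hb' : b * conj b = (normSq b : ℂ) := mul_conj b
  funext j
  fin_cases j
  · simp
  · simp
  · simp only [bdC, Fin.isValue, Matrix.cons_val_zero, Matrix.cons_val_one, Matrix.cons_val,
      normSq_zero, zero_add, map_mul, conj_conj, Pi.smul_apply, smul_eq_mul, map_inv₀, conj_ofReal]
    push_cast
    field_simp
    linear_combination c * hb'

/-- `GEinv ∘ GE = id` on `[a : b : c]`, `a ≠ 0`. [folklore] -/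
theorem GEinv_GE_aux₁ {a b c : ℂ} (ha : a ≠ 0) (h : (![a, b, c] : Fin 3 → ℂ) ≠ 0) :
    geInv₂ ((bdC ![a, b, c]).1, b / a) = pt ![a, b, c] h := by
  rw [geInv₂_eq]
  symm
  refine pt_eq_pt_of_smul _ _ a ?_
  have han : ((normSq a : ℝ) : ℂ) ≠ 0 := ofReal_ne_zero.2 (by rwa [Ne, normSq_eq_zero])
  have hN : ((normSq a : ℝ) : ℂ) + (normSq b : ℂ) ≠ 0 := by
    have : (0 : ℝ) < normSq a + normSq b :=
      add_pos_of_pos_of_nonneg (normSq_pos.2 ha) (normSq_nonneg b)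
    exact_mod_cast this.ne'
  have ha' : a * conj a = (normSq a : ℂ) := mul_conj a
  funext j
  fin_cases j
  · simp
  · simp
    field_simp
  · simp only [bdC, Fin.isValue, Matrix.cons_val_zero, Matrix.cons_val_one, Matrix.cons_val, map_mul,
      conj_conj, Pi.smul_apply, smul_eq_mul, normSq_div, map_inv₀, conj_ofReal]
    push_cast
    field_simp
    linear_combination c * ha'

/-- **`GEinv ∘ GE = id` off `q`.** [folklore] -/
theorem GEinv_GE {y : ComplexProjectivePlane} (hy : y ≠ qPt) : GEinv (GE y) = y := by
  induction y using ind with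
  | h v =>
    obtain ⟨v, hv0⟩ := v
    have hvec : v = ![v 0, v 1, v 2] := by funext j; fin_cases j <;> rfl
    have hv0' : (![v 0, v 1, v 2] : Fin 3 → ℂ) ≠ 0 := hvec ▸ hv0
    have hpt : mk ⟨v, hv0⟩ = pt ![v 0, v 1, v 2] hv0' := pt_congr _ _ hvec
    rw [hpt] at hy ⊢
    by_cases h0 : v 0 = 0
    · have h1 : v 1 ≠ 0 := fun h1 => hy ((pt_eq_qPt_iff _).2 ⟨by simp [h0], by simp [h1]⟩)
      have hpt' : pt ![v 0, v 1, v 2] hv0' = pt ![0, v 1, v 2] (vec3_ne_zero 1 (by simpa using h1)) :=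
        pt_congr _ _ (by rw [h0])
      rw [hpt', GE_pt_of_eq_zero _ (by simp), GEinv_Φ₃]
      exact GEinv_GE_aux₀ h1 _
    · rw [GE_pt_of_ne_zero _ (by simpa using h0), GEinv_Φ₂]
      simpa using GEinv_GE_aux₁ (b := v 1) (c := v 2) h0 hv0'

/-- `GEinv` takes values off `q` on `U₂ ∪ U₃`. [folklore] -/
theorem GEinv_ne_qPt {v : Model} (hv : v ∉ sFibre) : GEinv v ≠ qPt := by
  rcases (not_mem_sFibre_iff v).1 hv with ⟨p, rfl⟩ | ⟨p, rfl⟩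
  · rw [GEinv_Φ₂, geInv₂_eq, Ne, pt_eq_qPt_iff]; simp
  · rw [GEinv_Φ₃, geInv₃_eq, Ne, pt_eq_qPt_iff]; simp

/-- `GE` is injective off `q`. [folklore] -/
theorem GE_injOn : InjOn GE {y | y ≠ qPt} := fun y hy y' hy' h => by
  rw [← GEinv_GE hy, ← GEinv_GE hy', h]

/-- **The image of `ℂℙ² ∖ {q}` under `GE` is `U₂ ∪ U₃ = Ṽ ∖ sFibre`.** [folklore] -/
theorem image_GE : GE '' {y | y ≠ qPt} = sFibreᶜ :=
  Subset.antisymm (by rintro _ ⟨y, -, rfl⟩; exact GE_not_mem_sFibre y) fun v hv =>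
    ⟨GEinv v, GEinv_ne_qPt hv, GE_GEinv hv⟩

/-! ### Smoothness -/

/-- The affine charts are in the maximal atlas of `ℂℙ²` at the literal model `𝓡 4`. [folklore] -/
theorem affineChart_mem_maximalAtlas (i : Fin 3) :
    (affineChart (n := 2) i : OpenPartialHomeomorph ComplexProjectivePlane (𝔼 4)) ∈
      IsManifold.maximalAtlas (𝓡 4) ∞ ComplexProjectivePlane :=
  IsManifold.subset_maximalAtlas (I := 𝓡 4) (M := ComplexProjectivePlane) ⟨i, rfl⟩

/-- The affine charts are smooth on their sources (literal model `𝓡 4`). [folklore] -/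
theorem contMDiffAt_affineChart {i : Fin 3} {y : ComplexProjectivePlane} (hy : CoordNeZero i y) :
    ContMDiffAt (𝓡 4) 𝓘(ℝ, 𝔼 4) ∞
      (affineChart (n := 2) i : OpenPartialHomeomorph ComplexProjectivePlane (𝔼 4)) y :=
  contMDiffAt_of_mem_maximalAtlas (affineChart_mem_maximalAtlas i) hy

/-- The inverse affine charts are smooth (literal model `𝓡 4`). [folklore] -/
theorem contMDiff_affineChart_symm' (i : Fin 3) :
    ContMDiff 𝓘(ℝ, 𝔼 4) (𝓡 4) ∞
      ((affineChart (n := 2) i : OpenPartialHomeomorph ComplexProjectivePlane (𝔼 4)).symm) := by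
  have h := contMDiffOn_symm_of_mem_maximalAtlas (affineChart_mem_maximalAtlas i)
  rwa [affineChart_target, contMDiffOn_univ] at h

/-- The chart-`0` expression of `GE` is smooth. [folklore] -/
theorem contDiff_GE_chart₀ : ContDiff ℝ ∞ fun w : 𝔼 4 =>
    ((conj (toC2 w).2 * (((1 + normSq (toC2 w).1 : ℝ) : ℂ))⁻¹, (toC2 w).1) : ℂ × ℂ) := by
  have hu : ContDiff ℝ ∞ fun w : 𝔼 4 => (toC2 w).1 := contDiff_fst.comp contDiff_toC2
  have hv : ContDiff ℝ ∞ fun w : 𝔼 4 => (toC2 w).2 := contDiff_snd.comp contDiff_toC2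
  have hn : ContDiff ℝ ∞ fun w : 𝔼 4 => (((1 + normSq (toC2 w).1 : ℝ) : ℂ)) :=
    ofRealCLM.contDiff.comp (contDiff_const.add (contDiff_normSq.comp hu))
  have h0 : ∀ w : 𝔼 4, (((1 + normSq (toC2 w).1 : ℝ) : ℂ)) ≠ 0 := fun w =>
    ofReal_ne_zero.2 (add_pos_of_pos_of_nonneg one_pos (normSq_nonneg _)).ne'
  exact ((conjCLE.contDiff.comp hv).mul (hn.inv h0)).prodMk hu

/-- The chart-`1` expression of `GE` is smooth. [folklore] -/
theorem contDiff_GE_chart₁ : ContDiff ℝ ∞ fun w : 𝔼 4 =>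
    (((toC2 w).1, conj (toC2 w).2 * (((normSq (toC2 w).1 + 1 : ℝ) : ℂ))⁻¹) : ℂ × ℂ) := by
  have hu : ContDiff ℝ ∞ fun w : 𝔼 4 => (toC2 w).1 := contDiff_fst.comp contDiff_toC2
  have hv : ContDiff ℝ ∞ fun w : 𝔼 4 => (toC2 w).2 := contDiff_snd.comp contDiff_toC2
  have hn : ContDiff ℝ ∞ fun w : 𝔼 4 => (((normSq (toC2 w).1 + 1 : ℝ) : ℂ)) :=
    ofRealCLM.contDiff.comp ((contDiff_normSq.comp hu).add contDiff_const)
  have h0 : ∀ w : 𝔼 4, (((normSq (toC2 w).1 + 1 : ℝ) : ℂ)) ≠ 0 := fun w =>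
    ofReal_ne_zero.2 (add_pos_of_nonneg_of_pos (normSq_nonneg _) one_pos).ne'
  exact hu.prodMk ((conjCLE.contDiff.comp hv).mul (hn.inv h0))

/-- **`GE` is smooth off `q`.** [folklore] -/
theorem contMDiffAt_GE {y : ComplexProjectivePlane} (hy : y ≠ qPt) :
    ContMDiffAt (𝓡 4) 𝓘(ℝ, ℂ × ℂ) ∞ GE y := by
  by_cases h0 : CoordNeZero 0 y
  · set e := (affineChart (n := 2) 0 : OpenPartialHomeomorph ComplexProjectivePlane (𝔼 4))
    have hev : GE =ᶠ[𝓝 y] (fun w : 𝔼 4 => Φ₂ (conj (toC2 w).2 *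
        (((1 + normSq (toC2 w).1 : ℝ) : ℂ))⁻¹, (toC2 w).1)) ∘ e := by
      filter_upwards [e.open_source.mem_nhds h0] with y' hy'
      simp only [comp_apply]
      conv_lhs => rw [← e.left_inv hy']
      exact GE_affine₀ _
    refine ContMDiffAt.congr_of_eventuallyEq ?_ hev
    exact (contMDiff_Φ₂.comp contDiff_GE_chart₀.contMDiff).contMDiffAt.comp y
      (contMDiffAt_affineChart h0)
  · have h1 : CoordNeZero 1 y := by
      induction y using ind with
      | h v =>
        rw [mk_eq_pt] at hy
        by_contra h1
        exact hy ((pt_eq_qPt_iff _).2 ⟨not_not.1 h0, not_not.1 h1⟩)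
    set e := (affineChart (n := 2) 1 : OpenPartialHomeomorph ComplexProjectivePlane (𝔼 4))
    have hev : GE =ᶠ[𝓝 y] (fun w : 𝔼 4 => Φ₃ ((toC2 w).1, conj (toC2 w).2 *
        (((normSq (toC2 w).1 + 1 : ℝ) : ℂ))⁻¹)) ∘ e := by
      filter_upwards [e.open_source.mem_nhds h1] with y' hy'
      simp only [comp_apply]
      conv_lhs => rw [← e.left_inv hy']
      exact GE_affine₁ _
    refine ContMDiffAt.congr_of_eventuallyEq ?_ hev
    exact (contMDiff_Φ₃.comp contDiff_GE_chart₁.contMDiff).contMDiffAt.comp y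
      (contMDiffAt_affineChart h1)

/-- `GE` is smooth on `ℂℙ² ∖ {q}`. [folklore] -/
theorem contMDiffOn_GE : ContMDiffOn (𝓡 4) 𝓘(ℝ, ℂ × ℂ) ∞ GE {y | y ≠ qPt} := fun _ hy =>
  (contMDiffAt_GE hy).contMDiffWithinAt

/-- `geInv₂` is smooth. [folklore] -/
theorem contMDiff_geInv₂ : ContMDiff 𝓘(ℝ, ℂ × ℂ) (𝓡 4) ∞ geInv₂ := by
  have hn : ContDiff ℝ ∞ fun p : ℂ × ℂ => (((1 + normSq p.2 : ℝ) : ℂ)) :=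
    ofRealCLM.contDiff.comp (contDiff_const.add (contDiff_normSq.comp contDiff_snd))
  have h : ContDiff ℝ ∞ fun p : ℂ × ℂ =>
      fromC2 (p.2, conj p.1 * (((1 + normSq p.2 : ℝ) : ℂ))) :=
    contDiff_fromC2.comp (contDiff_snd.prodMk ((conjCLE.contDiff.comp contDiff_fst).mul hn))
  exact (contMDiff_affineChart_symm' 0).comp h.contMDiff

/-- `geInv₃` is smooth. [folklore] -/
theorem contMDiff_geInv₃ : ContMDiff 𝓘(ℝ, ℂ × ℂ) (𝓡 4) ∞ geInv₃ := by
  have hn : ContDiff ℝ ∞ fun p : ℂ × ℂ => (((normSq p.1 + 1 : ℝ) : ℂ)) :=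
    ofRealCLM.contDiff.comp ((contDiff_normSq.comp contDiff_fst).add contDiff_const)
  have h : ContDiff ℝ ∞ fun p : ℂ × ℂ =>
      fromC2 (p.1, conj p.2 * (((normSq p.1 + 1 : ℝ) : ℂ))) :=
    contDiff_fromC2.comp (contDiff_fst.prodMk ((conjCLE.contDiff.comp contDiff_snd).mul hn))
  exact (contMDiff_affineChart_symm' 1).comp h.contMDiff

/-- **`GEinv` is smooth off the south-pole fibre.** [folklore] -/
theorem contMDiffAt_GEinv {v : Model} (hv : v ∉ sFibre) :
    ContMDiffAt 𝓘(ℝ, ℂ × ℂ) (𝓡 4) ∞ GEinv v := by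
  rcases (not_mem_sFibre_iff v).1 hv with ⟨p, rfl⟩ | ⟨p, rfl⟩
  · exact contMDiffAt_of_comp_isImmersionAt (isSmoothEmbedding_Φ₂.isImmersion.isImmersionAt p)
      isOpenMap_Φ₂ contMDiff_geInv₂.contMDiffAt GEinv_Φ₂
  · exact contMDiffAt_of_comp_isImmersionAt (isSmoothEmbedding_Φ₃.isImmersion.isImmersionAt p)
      isOpenMap_Φ₃ contMDiff_geInv₃.contMDiffAt GEinv_Φ₃

/-- `{q}ᶜ` is open. [folklore] -/
theorem isOpen_ne_qPt : IsOpen {y : ComplexProjectivePlane | y ≠ qPt} := isOpen_ne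

/-- **`ℂℙ² ∖ {q} ≅ U₂ ∪ U₃`** as an open partial homeomorphism. [folklore] -/
def GEPH : OpenPartialHomeomorph ComplexProjectivePlane Model where
  toFun := GE
  invFun := GEinv
  source := {y | y ≠ qPt}
  target := sFibreᶜ
  map_source' y _ := GE_not_mem_sFibre y
  map_target' _ hv := GEinv_ne_qPt hv
  left_inv' _ hy := GEinv_GE hy
  right_inv' _ hv := GE_GEinv hv
  open_source := isOpen_ne_qPt
  open_target := isClosed_sFibre.isOpen_compl
  continuousOn_toFun := contMDiffOn_GE.continuousOn
  continuousOn_invFun := fun _ hv => (contMDiffAt_GEinv hv).continuousAt.continuousWithinAt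

/-- `GEPH` acts as `GE`. [folklore] -/
@[simp] theorem GEPH_apply (y : ComplexProjectivePlane) : GEPH y = GE y := rfl

/-- Its inverse acts as `GEinv`. [folklore] -/
@[simp] theorem GEPH_symm_apply (v : Model) : GEPH.symm v = GEinv v := rfl

/-- Its source is `ℂℙ² ∖ {q}`. [folklore] -/
@[simp] theorem GEPH_source : GEPH.source = {y | y ≠ qPt} := rfl

/-- Its target is `U₂ ∪ U₃`. [folklore] -/
@[simp] theorem GEPH_target : GEPH.target = sFibreᶜ := rfl

/-- `GEPH` is smooth on its source. [folklore] -/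
theorem contMDiffOn_GEPH : ContMDiffOn (𝓡 4) 𝓘(ℝ, ℂ × ℂ) ∞ GEPH GEPH.source := contMDiffOn_GE

/-- `GEPH.symm` is smooth on its target. [folklore] -/
theorem contMDiffOn_GEPH_symm : ContMDiffOn 𝓘(ℝ, ℂ × ℂ) (𝓡 4) ∞ GEPH.symm GEPH.target :=
  fun _ hv => (contMDiffAt_GEinv hv).contMDiffWithinAt

/-! ### The embedding of the second summand -/

/-- **The embedding of the punctured projective plane used in the neck presentation**:
`eTwo = squeezeM ∘ GE`. [folklore] -/
def eTwo (y : ComplexProjectivePlane) : Model := squeezeM (GE y)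

/-- The embedding as a composite of partial homeomorphisms. [folklore] -/
def eTwoPH : OpenPartialHomeomorph ComplexProjectivePlane Model := GEPH.trans' squeezePH rfl

/-- `eTwoPH` acts as `eTwo`. [folklore] -/
@[simp] theorem eTwoPH_apply (y : ComplexProjectivePlane) : eTwoPH y = eTwo y := rfl

/-- The source of `eTwoPH` is `ℂℙ² ∖ {q}`. [folklore] -/
@[simp] theorem eTwoPH_source : eTwoPH.source = {y | y ≠ qPt} := rfl

/-- The target of `eTwoPH` is `{bdRad < 1/8} ∖ sFibre`. [folklore] -/
theorem eTwoPH_target : eTwoPH.target = {v | v ∉ sFibre ∧ bdRad v < 8⁻¹} := rfl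

/-- **The range of `eTwo` on `ℂℙ² ∖ {q}`** is `{bdRad < 1/8} ∖ sFibre`. [folklore] -/
theorem image_eTwo : eTwo '' {y | y ≠ qPt} = {v | v ∉ sFibre ∧ bdRad v < 8⁻¹} := by
  rw [← eTwoPH_target, ← eTwoPH_source, ← eTwoPH.image_source_eq_target]
  rfl

/-- `eTwo` is smooth off `q`. [folklore] -/
theorem contMDiffAt_eTwo {y : ComplexProjectivePlane} (hy : y ≠ qPt) :
    ContMDiffAt (𝓡 4) 𝓘(ℝ, ℂ × ℂ) ∞ eTwo y :=
  (contMDiffAt_squeezeM (GE_not_mem_sFibre y)).comp y (contMDiffAt_GE hy)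

/-- `eTwoPH` is smooth on its source. [folklore] -/
theorem contMDiffOn_eTwoPH : ContMDiffOn (𝓡 4) 𝓘(ℝ, ℂ × ℂ) ∞ eTwoPH eTwoPH.source := fun _ hy =>
  (contMDiffAt_eTwo hy).contMDiffWithinAt

/-- `eTwoPH.symm` is smooth on its target. [folklore] -/
theorem contMDiffOn_eTwoPH_symm : ContMDiffOn 𝓘(ℝ, ℂ × ℂ) (𝓡 4) ∞ eTwoPH.symm eTwoPH.target := by
  rw [eTwoPH_target]
  intro v hv
  have h1 : ContMDiffAt 𝓘(ℝ, ℂ × ℂ) 𝓘(ℝ, ℂ × ℂ) ∞ unsqueezeM v := contMDiffAt_unsqueezeM hv.1 hv.2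
  have h2 : ContMDiffAt 𝓘(ℝ, ℂ × ℂ) (𝓡 4) ∞ GEinv (unsqueezeM v) :=
    contMDiffAt_GEinv (unsqueezeM_not_mem_sFibre hv.1 hv.2)
  exact (h2.comp v h1).contMDiffWithinAt

/-- `eTwo` is injective off `q`. [folklore] -/
theorem eTwo_injOn : InjOn eTwo {y | y ≠ qPt} := eTwoPH.injOn

/-- **The matching of the second summand**: on the disc centred at `q`,
`eTwo ([t θ : 1]) = liftDisc (γ(-t) • θ)` for a unit vector `θ` and `t > 0` — the squeezed image of
the point at parameter `t` lies at blow-down radius `γ(-t) = h(1/t)` in the direction `θ`.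
[folklore] -/
theorem eTwo_affine₂_smul {θ : 𝔼 4} (hθ : ‖θ‖ = 1) {t : ℝ} (ht : 0 < t) :
    eTwo ((affineChart (n := 2) 2).symm (t • θ)) = liftDisc (neckProfile (-t) • θ) := by
  have hθ0 : θ ≠ 0 := by rintro rfl; simp at hθ
  have htθ : t • θ ≠ 0 := smul_ne_zero ht.ne' hθ0
  have hnorm : ‖t • θ‖ = t := by rw [norm_smul, hθ, mul_one, Real.norm_of_nonneg ht.le]
  have h1 : (‖t • θ‖ ^ 2)⁻¹ • (t • θ) = t⁻¹ • θ := by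
    rw [hnorm, smul_smul]; congr 1; field_simp
  have ht' : 0 < t⁻¹ := inv_pos.2 ht
  rw [eTwo, GE_affine₂ htθ, h1, squeezeM_liftDisc (smul_ne_zero ht'.ne' hθ0),
    neckSqueeze_smul hθ ht', neckProfile_neg ht]

end ToricBlowup

end Literature.Topology.FourManifolds
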